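import Summits.ResolutionOfSingularities.ResolutionOfSingularities.Theorems.UniformComplexityCampaignW82AlgClosedKernel
import Mathlib.FieldTheory.AlgebraicClosure
import Mathlib.Algebra.CharP.IntermediateField
import HarnessLib

/-!
# [OURS · L1 W8.2] The door-2 climb kernel and perfection step at the algebraic closures of FINITELY
# GENERATED subfields — door 2's residual at FINITE TRANSCENDENCE DEGREE over `𝔽_p`; Theses-free module

Cell `res-hironaka` (run/shared/lean/pub/res-hironaka/), LADDER-RESOLUTION rung L (RESCUE), slot W8.2 of
plan/RESCUE-SEED.md («PRIME-FIELD / UNIVERSALITY TRANSFER instead of descent»), SECOND DOOR: route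
`UniformComplexity`, item `PrimeModelTransfer` (stmt-ResolutionOfSingularities-8933: resolution over the
algebraically closed fields algebraic over `𝔽_p` ⇒ resolution over every algebraically closed field of
characteristic `p`). Sibling of Theorems/UniformComplexityCampaignW82AlgClosedKernel.lean (p470934, «v1» below;
kept byte-identical — this is a new module because the 400-line bound forbids appending there). Statement-only
file (typer res-L1-type-o6, statement-only lane; two-lane rule: the slot's prover res-L1-s82-pv-2 proves AGAINST
these names): three OURS `Prop`s and seven pure-logic anchors; NOTHING is proved about resolution of
singularities here and nothing is asserted.

WHY THIS FILE. The closer announced in v1 has LANDED: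
`Theorems.PrimeModelTransfer.primeModelTransfer_of_climbAlgClosed`
(Theorems/UniformComplexityPrimeModelTransferOfClimbAlgClosed.lean, res-L1-s82-pv-2, p470915; sorry-free)
concludes `Theses.UniformComplexity.PrimeModelTransfer` BY NAME from a hypothesis `hker` which IS
`∀ p, p.Prime → CampaignW82.ClimbRatFuncPerfAlgClosed p` unfolded binder for binder (pure-logic link
`CampaignW82.primeModelTransfer_of_forall_climbRatFuncPerfAlgClosed`,
Theorems/UniformComplexityCampaignW82AlgClosedKernelLinks.lean, p473045) — so v1's docstring phrase «expected
to suffice … not proved here» is SUPERSEDED: it suffices, kernel-checked (lane-A remark res-L1-ref-a2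
2026-08-26T22:58:45Z; v1 is left byte-identical on purpose, this paragraph is the correction of record). That
closer's transcendence-degree induction only ever meets constant fields of the form

  `M = algebraicClosure (Subfield.closure ↑s) K` — the relative algebraic closure `(𝔽_p(s))^{alg} ∩ K` of the
  subfield generated by a FINITE subset `s` of the algebraically closed target `K`,

i.e. algebraically closed fields of FINITE transcendence degree (`≤ #s`) over `𝔽_p`, presented INSIDE `K` and
without `Algebra.trdeg`, exactly as in pv-2's second closer
`Theorems.PrimeModelTransfer.primeModelTransfer_of_algebraicClosure_fg` (same file p470915: `PrimeModelTransfer`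
⇐ resolution over these `M` for every `K`, `s`). res-L1-s82-pv-2 (STATUS 2026-08-26T22:51:00Z): «YES to the
sharper finite-trdeg sibling — `ClimbRatFuncPerfAlgClosureFg p := ∀ K [Field K] [CharP K p] [IsAlgClosed K]
(s : Finset K), M := algebraicClosure (Subfield.closure ↑s) K; Res(M) → ∀ L [PerfectField L]
[Algebra (RatFunc M) L] [IsPurelyInseparable (RatFunc M) L], Res(L)` … append it when convenient; I prove the
closer against the unfolded form meanwhile.» This file types exactly that — the field `M` WRITTEN OUT at each
occurrence (no `let`, so a closer stated against the unfolded form matches these names by `Iff.rfl`) — with its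
dimension-graded form and the corresponding perfection step, linked to the v1 names by pure logic plus three
Mathlib instances: `IntermediateField.charP'` (`CharP M p` from `CharP K p`), `IsAlgClosure.isAlgClosed` (`M` is
algebraically closed: instance `algebraicClosure.isAlgClosure` for `[IsAlgClosed K]`), `IsAlgClosed.perfectField`.

CONTENT (non-embedded summit idiom as in p466046 / p469608 / p470934):
* `ClimbRatFuncPerfAlgClosureFg p` — the door-2 kernel `ClimbRatFuncPerfAlgClosed p` with the constant field
  SPECIALISED to `M = algebraicClosure (Subfield.closure ↑s) K` (`K` algebraically closed of characteristic `p`,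
  `s : Finset K`); implied by it (`climbRatFuncPerfAlgClosureFg_of_climbRatFuncPerfAlgClosed`).
* `ClimbRatFuncPerfAlgClosureFgDimLe p m n` — the same graded by dimension; `(⊤, ⊤)` = the above
  (`climbRatFuncPerfAlgClosureFg_iff_top`); monotone (`climbRatFuncPerfAlgClosureFgDimLe_mono`); implied by the
  door-2 grade and by the registered kernel grade (`…_of_climbRatFuncPerfAlgClosedDimLe`,
  `…_of_climbRatFuncPerfDimLe`).
* `PerfectionStepAlgClosureFgDimLe p n` — the perfection step at these `M`: door 2's honest residual at finite
  transcendence degree, grade `n`; implied by `PerfectionStepAlgClosedDimLe p n`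
  (`perfectionStepAlgClosureFgDimLe_of_perfectionStepAlgClosedDimLe`).
* `climbRatFuncPerfAlgClosureFgDimLe_of_spreadOut_of_perfectionStepAlgClosureFg` — THE FACTORISATION at finite
  transcendence degree: `SpreadOutRatFuncDimLe p m n → PerfectionStepAlgClosureFgDimLe p n →
  ClimbRatFuncPerfAlgClosureFgDimLe p m n`. Since `SpreadOutRatFuncDimLe p (n + 1) n` is now a THEOREM
  (`CampaignW82.familyTransferSucc_holds`, Theorems/UniversalCellsCampaignW82FamilyTransferGradedProofs.lean,
  res-L1-s82-pv-1, p473029 — not imported here, to keep this vocabulary module light; consumers compose), the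
  finite-trdeg door-2 kernel at `(n + 1, n)` rests on `PerfectionStepAlgClosureFgDimLe p n` alone.

WHAT THE SPECIALISATION BUYS — recorded honestly. `M = (𝔽_p(s))^{alg} ∩ K` is COUNTABLE, algebraically closed,
of transcendence degree `≤ #s` over `𝔽_p`; at `s = ∅` (more generally `s ⊆ 𝔽̄_p ∩ K`) it is the algebraic
closure of the prime field in `K`, a copy of `𝔽̄_p`, and the hypothesis «resolution over `M`» is then — up to
transport along a ring isomorphism, cf. `Theorems.PrimeModelTransfer.hasResolution_of_integralResOver_ringEquiv`
(p470438) — door 2's OWN crux hypothesis; so the `s = ∅` instance of `ClimbRatFuncPerfAlgClosureFg p` reads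
«resolution over the algebraically closed fields algebraic over `𝔽_p` ⇒ resolution over `𝔽̄_p(t)^{perf}`». No
catalogued barrier and no catalogued theorem distinguishes countable / finite-trdeg algebraically closed `M` from
arbitrary algebraically closed or perfect `M` for the perfection step: the transport barriers
(`Literature/Barriers/ResolutionOfSingularities/`, namespace `Literature.Barriers.ResolutionOfSingularities`:
file `RegularNotGeometricallyRegular.lean` (Kollár 1.19); file `FrobeniusTwistResolution.lean`, decl
`not_hasResolution_Spec_frobTwist`, stated over `RatFunc (ZMod p)`; file `InseparableBaseChangeResolution.lean`,
decls `not_hasResolution_Spec_dualNumber` / `not_hasResolution_pullback_extField` /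
`not_isRegular_stable_groundFieldExtension`) concern the purely inseparable extension `M(t) ⊂ M(t)^{perf}` of
the imperfect field `M(t)`, imperfect for EVERY `M`. Rungs: `n ≤ 3` theorems from the named fact
`CossartPiltant2019` (FACT-LIST F-02) via `CampaignW82.perfectionStepDimLe_of_le_three` (p473029) and the `_of_`
anchors below; `PerfectionStepAlgClosureFgDimLe p 4` is door 2's first open rung in its sharpest form —
open-problem grade, like `PerfectionStepAlgClosedDimLe p 4` and `PerfectionStepDimLe p 4`.

BUILD RULE (cell, director-resolution 2026-08-26T18:53:29Z (B)): OURS vocabulary file, THESES-FREE BY BIRTH —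
imports only the Theses-free module p470934 (hence p469608, p466046), `Mathlib.FieldTheory.AlgebraicClosure`,
`Mathlib.Algebra.CharP.IntermediateField` and `HarnessLib`.

HONEST FRAMING. The `def`s below are OURS — campaign statements that REPLACE THE ROLE of a printed item of
H. Hironaka's manuscript *Resolution of singularities in positive characteristics* (2017-03-23, [Hironaka2017],
lit key `paper:url-3343fd9e678b`) — §17 ¶2, p.89 l.59–62 («In this work the base field K is always assumed to
be a finite field or Z/pZ because our resolution is for all dimension. When the K has transcendence degree d we
can reformulate the resolution problem to the case of dimension d + dim Z»; typed AS PRINTED as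
`Literature.AlgebraicGeometry.Hironaka2017.S17Methodology.U89_3` / `U89_3_ours`, named only, not consumed) —
for door 2's universe, at FINITE transcendence degree `d = #s` over the prime field (the printed device's own
regime), one transcendental and one algebraic closure at a time. NOT statements of the manuscript; nothing here
is attributed to its author; no typed candidate of the manuscript is used even as a hypothesis. AI
transcription, weaker than expert review.

VACUITY SELF-CHECK (one line per decl in the docstrings; prime `p`): none of the three `Prop`s is trivially
false (each instance follows from the summit statement `ResolutionInChar p`); none is trivially true — already
at `s = ∅` the conclusion contains resolution of integral schemes of dimension `≥ 4` over `𝔽̄_p(t)^{perf}`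
(open); the graded ones are trivially true exactly at `n = ⊥`; at `m = ⊥` the hypothesis of
`ClimbRatFuncPerfAlgClosureFgDimLe` is idle. Composite `p > 1`: vacuous (no field `K`); `p = 0`: not intended
(then `K ⊇ ℚ`; not vacuous).

## References (vocabulary and locators only; nothing cited as a premise)
* H. Hironaka, ms. 2017-03-23, §17 ¶2 p.89 l.59–62 — under adjudication, quoted for the role replaced, not
  asserted. [Hironaka2017]
* J. Kollár, *Lectures on Resolution of Singularities* (2007), 1.19 — the barrier example (catalogued, not used
  here). [Kollar2007]
* Cruxes/PrimeModelTransfer/STRATEGY-CENSUS.md («Transfer»); L/res-L1-k82/KILL-TEST-K8.2.md §4; L/SLOTS.md §2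
  W8.2; res-L1-s82-pv-2 STATUS 2026-08-26T21:30:44Z / 22:51:00Z — cell files, OURS.
-/

noncomputable section

set_option linter.dupNamespace false -- mandated namespace of this single-conjunct summit

open _root_.CategoryTheory _root_.AlgebraicGeometry
open Literature.AlgebraicGeometry.Resolution

namespace Summit.ResolutionOfSingularities.ResolutionOfSingularities.Theorems.CampaignW82

/-! ## The door-2 kernel at `M = (𝔽_p(s))^{alg} ∩ K`, `s` finite -/

/-- [OURS · L1 W8.2] replaces the role of §17 ¶2, p.89 l.59–62 («a finite field or Z/pZ … When the K has
transcendence degree d we can reformulate the resolution problem to the case of dimension d + dim Z»; typed as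
`S17Methodology.U89_3` / `U89_3_ours`) ONE TRANSCENDENTAL AT A TIME over an algebraically closed constant field
OF FINITE TRANSCENDENCE DEGREE over `𝔽_p`, for door 2 (`UniformComplexity.PrimeModelTransfer`, stmt-8933), in
the non-embedded summit idiom; NOT a statement of the manuscript.
THE DOOR-2 KERNEL AT THE ALGEBRAIC CLOSURE OF A FINITELY GENERATED SUBFIELD, at `p`: for every algebraically
closed field `K` of characteristic `p` and every finite `s ⊆ K`, writing `M := algebraicClosure
(Subfield.closure ↑s) K` (the relative algebraic closure `(𝔽_p(s))^{alg} ∩ K`, an algebraically closed subfield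
of `K` of transcendence degree `≤ #s` over `𝔽_p`; written out below, no `let`): if all integral separated
`M`-schemes of finite type have resolutions, then all integral separated schemes of finite type over every
PERFECT field `L` purely inseparable over `RatFunc M` (`L ≅ M(t)^{perf}`) have resolutions. Binder shape =
res-L1-s82-pv-2's request (STATUS 2026-08-26T22:51:00Z) = the presentation of
`Theorems.PrimeModelTransfer.primeModelTransfer_of_algebraicClosure_fg` (p470915). Implied by
`ClimbRatFuncPerfAlgClosed p` (`climbRatFuncPerfAlgClosureFg_of_climbRatFuncPerfAlgClosed`: `M` is algebraically
closed of characteristic `p`), hence by the registered kernel `CampaignW82.ClimbRatFuncPerf p`; these `M` are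
exactly the constant fields met by the trdeg induction of `primeModelTransfer_of_climbAlgClosed` (p470915) — the
closer `(∀ p, p.Prime → ClimbRatFuncPerfAlgClosureFg p) → PrimeModelTransfer` is pv-2's, not proved here. Door
2's residual at finite transcendence degree. Vacuity (prime `p`): not trivially true (at `s = ∅`, `M ≅ 𝔽̄_p` and
the conclusion contains resolution in dimension `≥ 4` over `𝔽̄_p(t)^{perf}`, open; the hypothesis is then door
2's own crux hypothesis up to transport) nor trivially false (implied by `ResolutionInChar p`); composite
`p > 1` vacuous. [folklore] -/
def ClimbRatFuncPerfAlgClosureFg (p : ℕ) : Prop :=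
  ∀ (K : Type) [Field K] [CharP K p] [IsAlgClosed K] (s : Finset K),
    (∀ (X : Scheme.{0}) (f : X ⟶ Spec (.of (algebraicClosure (Subfield.closure (↑s : Set K)) K))),
        IsSeparated f → LocallyOfFiniteType f → QuasiCompact f → IsIntegral X → Scheme.HasResolution X) →
      ∀ (L : Type) [Field L] [PerfectField L]
        [Algebra (RatFunc (algebraicClosure (Subfield.closure (↑s : Set K)) K)) L]
        [IsPurelyInseparable (RatFunc (algebraicClosure (Subfield.closure (↑s : Set K)) K)) L]
        (X : Scheme.{0}) (f : X ⟶ Spec (.of L)),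
        IsSeparated f → LocallyOfFiniteType f → QuasiCompact f → IsIntegral X → Scheme.HasResolution X

/-- [OURS · L1 W8.2] replaces the role of §17 ¶2, p.89 l.59–62 one transcendental at a time over an
algebraically closed constant field OF FINITE TRANSCENDENCE DEGREE over `𝔽_p`, GRADED BY DIMENSION on both sides
(door 2); NOT a statement of the manuscript. THE GRADED DOOR-2 KERNEL AT `M = algebraicClosure
(Subfield.closure ↑s) K`, bounds `(m, n)`: for every algebraically closed `K` of characteristic `p` and every
finite `s ⊆ K`, if every integral separated `M`-scheme of finite type of dimension `≤ m` has a resolution, then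
every integral separated scheme of finite type of dimension `≤ n` over every perfect field `L` purely
inseparable over `RatFunc M` has a resolution. `ClimbRatFuncPerfAlgClosedDimLe p m n` (v1) with `M`
specialised, and implied by it (`climbRatFuncPerfAlgClosureFgDimLe_of_climbRatFuncPerfAlgClosedDimLe`);
`(⊤, ⊤)` is `ClimbRatFuncPerfAlgClosureFg p` (`climbRatFuncPerfAlgClosureFg_iff_top`); monotone in `m`, antitone
in `n` (`climbRatFuncPerfAlgClosureFgDimLe_mono`); FACTORS through the finite level: `SpreadOutRatFuncDimLe p m n
→ PerfectionStepAlgClosureFgDimLe p n → ClimbRatFuncPerfAlgClosureFgDimLe p m n`. Rungs (not proved here):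
`n ≤ 3` from the named fact `CossartPiltant2019` (F-02); `(n + 1, n)` ⇐ `PerfectionStepAlgClosureFgDimLe p n`
alone (`SpreadOutRatFuncDimLe p (n + 1) n` is `familyTransferSucc_holds p n`, p473029); `(5, 4)` is the first
open rung. Vacuity (prime `p`): trivially true only at `n = ⊥`; at `m = ⊥` the hypothesis is idle; never
trivially false; composite `p > 1` vacuous. [folklore] -/
def ClimbRatFuncPerfAlgClosureFgDimLe (p : ℕ) (m n : WithBot ℕ∞) : Prop :=
  ∀ (K : Type) [Field K] [CharP K p] [IsAlgClosed K] (s : Finset K),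
    (∀ (X : Scheme.{0}) (f : X ⟶ Spec (.of (algebraicClosure (Subfield.closure (↑s : Set K)) K))),
        IsSeparated f → LocallyOfFiniteType f → QuasiCompact f → IsIntegral X →
          topologicalKrullDim X ≤ m → Scheme.HasResolution X) →
      ∀ (L : Type) [Field L] [PerfectField L]
        [Algebra (RatFunc (algebraicClosure (Subfield.closure (↑s : Set K)) K)) L]
        [IsPurelyInseparable (RatFunc (algebraicClosure (Subfield.closure (↑s : Set K)) K)) L]
        (X : Scheme.{0}) (f : X ⟶ Spec (.of L)),
        IsSeparated f → LocallyOfFiniteType f → QuasiCompact f → IsIntegral X →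
          topologicalKrullDim X ≤ n → Scheme.HasResolution X

/-! ## The perfection step at `M = (𝔽_p(s))^{alg} ∩ K`, `s` finite (door 2's residual at finite trdeg) -/

/-- [OURS · L1 W8.2] replaces the role of §17 ¶2, p.89 l.59–62 read with §2 p.4 l.22–24 («a perfect base field
K») for the target field `M(t)^{perf}` with `M = algebraicClosure (Subfield.closure ↑s) K` algebraically closed
OF FINITE TRANSCENDENCE DEGREE over `𝔽_p` (door 2), ISOLATED from the finite-level transfer and GRADED BY
DIMENSION; NOT a statement of the manuscript. THE PERFECTION STEP AT THE ALGEBRAIC CLOSURE OF A FINITELY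
GENERATED SUBFIELD, grade `n`: for every algebraically closed `K` of characteristic `p` and every finite
`s ⊆ K`, if every integral separated scheme of finite type of dimension `≤ n` over `RatFunc M = M(t)` has a
resolution, then every integral separated scheme of finite type of dimension `≤ n` over every perfect field `L`
purely inseparable over `RatFunc M` (`L ≅ M(t)^{perf}`) has a resolution. `PerfectionStepAlgClosedDimLe p n`
(v1) with `M` specialised, and implied by it (`perfectionStepAlgClosureFgDimLe_of_perfectionStepAlgClosedDimLe`),
hence by `CampaignW82.PerfectionStepDimLe p n` (p469608). With the finite-level family transfer it gives the
graded kernel of this file (`climbRatFuncPerfAlgClosureFgDimLe_of_spreadOut_of_perfectionStepAlgClosureFg`);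
with `familyTransferSucc_holds` (p473029) THIS is all that door 2 still asks, dimension by dimension, in its
sharpest form (`M` countable, of finite transcendence degree over `𝔽_p`). The hypothesis supplies REGULAR
models over the imperfect field `M(t)`; the conclusion needs a model SMOOTH at some finite level
`M(t^{1/p^e})`; «regular ⇒ geometrically regular» fails over `M(t)` for every `M` (barrier files
`RegularNotGeometricallyRegular.lean`, `InseparableBaseChangeResolution.lean`, `FrobeniusTwistResolution.lean`)
— neither algebraic closedness nor countability / finite transcendence degree of `M` is known to help. Rungs
(not proved here): `n ≤ 3` from `CossartPiltant2019` (F-02; hypothesis unused); `n = 4` is door 2's first open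
rung. Vacuity (prime `p`): trivially true only at `n = ⊥`; never trivially false; NOT monotone in `n`;
composite `p > 1` vacuous. [folklore] -/
def PerfectionStepAlgClosureFgDimLe (p : ℕ) (n : WithBot ℕ∞) : Prop :=
  ∀ (K : Type) [Field K] [CharP K p] [IsAlgClosed K] (s : Finset K),
    (∀ (X : Scheme.{0})
        (f : X ⟶ Spec (.of (RatFunc (algebraicClosure (Subfield.closure (↑s : Set K)) K)))),
        IsSeparated f → LocallyOfFiniteType f → QuasiCompact f → IsIntegral X →
          topologicalKrullDim X ≤ n → Scheme.HasResolution X) →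
      ∀ (L : Type) [Field L] [PerfectField L]
        [Algebra (RatFunc (algebraicClosure (Subfield.closure (↑s : Set K)) K)) L]
        [IsPurelyInseparable (RatFunc (algebraicClosure (Subfield.closure (↑s : Set K)) K)) L]
        (X : Scheme.{0}) (f : X ⟶ Spec (.of L)),
        IsSeparated f → LocallyOfFiniteType f → QuasiCompact f → IsIntegral X →
          topologicalKrullDim X ≤ n → Scheme.HasResolution X

/-! ## Pure-logic anchors -/

/-- **The ungraded finite-trdeg door-2 kernel is the grade `(⊤, ⊤)`** (pure logic, `le_top`). [folklore] -/
theorem climbRatFuncPerfAlgClosureFg_iff_top (p : ℕ) :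
    ClimbRatFuncPerfAlgClosureFg p ↔ ClimbRatFuncPerfAlgClosureFgDimLe p ⊤ ⊤ := by
  constructor
  · intro h K _ _ _ s hM L _ _ _ _ X f hs hl hq hX _
    exact h K s (fun Y g hs' hl' hq' hY => hM Y g hs' hl' hq' hY le_top) L X f hs hl hq hX
  · intro h K _ _ _ s hM L _ _ _ _ X f hs hl hq hX
    exact h K s (fun Y g hs' hl' hq' hY _ => hM Y g hs' hl' hq' hY) L X f hs hl hq hX le_top

/-- **Monotonicity** (pure logic): `ClimbRatFuncPerfAlgClosureFgDimLe p m n →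
ClimbRatFuncPerfAlgClosureFgDimLe p m' n'` whenever `m ≤ m'` and `n' ≤ n`. [folklore] -/
theorem climbRatFuncPerfAlgClosureFgDimLe_mono {p : ℕ} {m m' n n' : WithBot ℕ∞} (hm : m ≤ m')
    (hn : n' ≤ n) (h : ClimbRatFuncPerfAlgClosureFgDimLe p m n) :
    ClimbRatFuncPerfAlgClosureFgDimLe p m' n' :=
  fun K _ _ _ s hM L _ _ _ _ X f hs hl hq hX hd =>
    h K s (fun Y g hs' hl' hq' hY hdY => hM Y g hs' hl' hq' hY (hdY.trans hm)) L X f hs hl hq hX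
      (hd.trans hn)

/-- **The door-2 kernel grade implies the finite-trdeg door-2 kernel grade**: `M = algebraicClosure
(Subfield.closure ↑s) K` has characteristic `p` (instance `IntermediateField.charP'`) and is algebraically
closed (`IsAlgClosure.isAlgClosed`, instance `algebraicClosure.isAlgClosure` for `[IsAlgClosed K]`); otherwise
pure logic. [folklore] -/
theorem climbRatFuncPerfAlgClosureFgDimLe_of_climbRatFuncPerfAlgClosedDimLe {p : ℕ} {m n : WithBot ℕ∞}
    (h : ClimbRatFuncPerfAlgClosedDimLe p m n) : ClimbRatFuncPerfAlgClosureFgDimLe p m n :=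
  fun K _ _ _ s hM L _ _ _ _ X f hs hl hq hX hd => by
    haveI : IsAlgClosed (algebraicClosure (Subfield.closure (↑s : Set K)) K) :=
      IsAlgClosure.isAlgClosed (Subfield.closure (↑s : Set K))
    exact h (algebraicClosure (Subfield.closure (↑s : Set K)) K) hM L X f hs hl hq hX hd

/-- **The registered kernel grade implies the finite-trdeg door-2 kernel grade** (composition of v1's
`climbRatFuncPerfAlgClosedDimLe_of_climbRatFuncPerfDimLe` with the previous anchor): the position of this
file's kernel in the chain `ClimbRatFuncPerfDimLe p m n → ClimbRatFuncPerfAlgClosedDimLe p m n →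
ClimbRatFuncPerfAlgClosureFgDimLe p m n`. [folklore] -/
theorem climbRatFuncPerfAlgClosureFgDimLe_of_climbRatFuncPerfDimLe {p : ℕ} {m n : WithBot ℕ∞}
    (h : ClimbRatFuncPerfDimLe p m n) : ClimbRatFuncPerfAlgClosureFgDimLe p m n :=
  climbRatFuncPerfAlgClosureFgDimLe_of_climbRatFuncPerfAlgClosedDimLe
    (climbRatFuncPerfAlgClosedDimLe_of_climbRatFuncPerfDimLe h)

/-- **The door-2 kernel implies the finite-trdeg door-2 kernel** (ungraded form; via the grades `(⊤, ⊤)`).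
[folklore] -/
theorem climbRatFuncPerfAlgClosureFg_of_climbRatFuncPerfAlgClosed {p : ℕ} (h : ClimbRatFuncPerfAlgClosed p) :
    ClimbRatFuncPerfAlgClosureFg p :=
  (climbRatFuncPerfAlgClosureFg_iff_top p).2
    (climbRatFuncPerfAlgClosureFgDimLe_of_climbRatFuncPerfAlgClosedDimLe
      ((climbRatFuncPerfAlgClosed_iff_top p).1 h))

/-- **The perfection step at algebraically closed `M` implies the one at `M = algebraicClosure
(Subfield.closure ↑s) K`** (instances `IntermediateField.charP'`, `IsAlgClosure.isAlgClosed`; otherwise pure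
logic). [folklore] -/
theorem perfectionStepAlgClosureFgDimLe_of_perfectionStepAlgClosedDimLe {p : ℕ} {n : WithBot ℕ∞}
    (h : PerfectionStepAlgClosedDimLe p n) : PerfectionStepAlgClosureFgDimLe p n :=
  fun K _ _ _ s hM L _ _ _ _ X f hs hl hq hX hd => by
    haveI : IsAlgClosed (algebraicClosure (Subfield.closure (↑s : Set K)) K) :=
      IsAlgClosure.isAlgClosed (Subfield.closure (↑s : Set K))
    exact h (algebraicClosure (Subfield.closure (↑s : Set K)) K) hM L X f hs hl hq hX hd

/-- **THE FACTORISATION AT FINITE TRANSCENDENCE DEGREE** (pure logic; `IntermediateField.charP'` supplies the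
`CharP` binder of `SpreadOutRatFuncDimLe`): the finite-level family transfer at `(m, n)` (p469608, any constant
field) and the perfection step at `M = algebraicClosure (Subfield.closure ↑s) K`, grade `n`, give the
finite-trdeg door-2 kernel grade `(m, n)`. With `familyTransferSucc_holds p n` (p473029):
`PerfectionStepAlgClosureFgDimLe p n → ClimbRatFuncPerfAlgClosureFgDimLe p (n + 1) n`. [folklore] -/
theorem climbRatFuncPerfAlgClosureFgDimLe_of_spreadOut_of_perfectionStepAlgClosureFg {p : ℕ}
    {m n : WithBot ℕ∞} (h₁ : SpreadOutRatFuncDimLe p m n) (h₂ : PerfectionStepAlgClosureFgDimLe p n) :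
    ClimbRatFuncPerfAlgClosureFgDimLe p m n :=
  fun K _ _ _ s hM L _ _ _ _ X f hs hl hq hX hd =>
    h₂ K s (fun Y g hs' hl' hq' hY hdY =>
      h₁ (algebraicClosure (Subfield.closure (↑s : Set K)) K) hM Y g hs' hl' hq' hY hdY) L X f hs hl hq hX hd

end Summit.ResolutionOfSingularities.ResolutionOfSingularities.Theorems.CampaignW82

end
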